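import Summits.QuantumFields.YangMills.Theorems.BalabanUVNodesN16AveragingPin
import Literature.Analysis.Matrix.DetExp
import Literature.Analysis.Complex.RungeUnits
import Summits.QuantumFields.YangMills.Theorems.AlphaInputsT3ACv3NewtonLiftFlatLinearisation
import HarnessLib

/-!
# YM-DAG node N16 (NE3), the located averaging pin (42) ↔ (0.4) — part 35: WHY THE (42)∕(0.4) DISCREPANCY OF COARSE PLAQUETTE TRACES IS THIRD ORDER — equal determinants
# (the abelian part is transported EXACTLY) + second-order closeness of the logarithms ⇒ traces agree to `card·β·(e^α − 1)`; the matrix lemma, kernel-checked, and the reduction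
# of the one-step ACTION discrepancy of part 34 to two displayed inputs

Cell `pub-ymgap`, width seat `pub-ymgap-dag-n16-w3` (director-ym №197 ∕ HUMAN RULING D-0149), generation 9; part 35 of the W1b lineage (part 34 `…N16SchemeSandwich`: END (A) for any
scheme `s` ⇐ sandwich inputs + the ONE-STEP ACTION DISCREPANCY `D(U) = A^{(k)}(step42 U) − A^{(k)}(s U)`; g8's numerics `W3-PIN-ANATOMY-v6∕v7`: `|tr P₄₂ − tr P₀₄| ≈ 0.1ε³`, THIRD
order, and ZERO for abelian fields).  `--kind proof --supports stmt-QuantumFields-27366 --as helper` (K3⁸, KEY MAP v2; count-neutral; 0 `def`).  `bears_on: R4∕N16`.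

THE MECHANISM (why third order, why abelian-exact).  For a coarse plaquette `P` of either average, `P = Π_i e^{Y_i}` is a product of exponentials (the exponents `X_c` of (42)∕(0.4)
and the fine bond logarithms along the straight transporters), so `det P = e^{Σ tr Y_i}` (Liouville) and `tr log P = Σ_i tr Y_i` is an EXACTLY LINEAR (abelian) functional of the
fine field: the determinant of the average is the abelian average of the determinant (on small fields whose loop holonomies have principal logarithms with `card·‖log‖ < 2π`,
so that `tr log` and `log det` agree — a guard relative to the rank), and for abelian fields the two averages have EXACTLY gauge-equivalent outputs (this lineage's parts 11∕13:
`bavg_permCfg_eq_coarseGauge`, `expUnit_T04_eq_coarseGauge_bavg`, `cplaq_expUnit_T04_eq`) — so `det P₄₂ = det P₀₄` there, i.e. `tr log P₄₂ = tr log P₀₄`.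
The logarithms themselves differ at SECOND order (parts 22∕25∕26: first order is an exact coarse gauge, which cancels around the closed plaquette; the second order is commutators +
exp-remainders).  THIS FILE proves the matrix lemma that turns «equal traces of the logs + `β`-close logs of size `≤ α`» into «traces of the exponentials agree to
`card·β·(e^α − 1)`» — with `α = O(L·a)` and `β = O(a²)` that is THIRD order — and states the reduction with the two inputs displayed.
 * §1 (no declaration) the two-field exponential bound `‖e^x − e^y − (x − y)‖ ≤ ‖x − y‖·(e^{max ‖x‖ ‖y‖} − 1)` is the TREE's
   `Summit.QuantumFields.YangMills.Theorems.NewtonLiftFlat.norm_exp_sub_exp_sub_sub_le` (α-inputs lineage) — imported, not restated.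
 * §2 `norm_entry_le_norm`, `norm_trace_le` (`‖tr M‖ ≤ card·‖M‖` in the operator norm); ★★ `norm_trace_exp_sub_trace_exp_le_of_trace_eq` — `tr Y = tr Z` ⇒
   `‖tr e^Y − tr e^Z‖ ≤ card·‖Y − Z‖·(e^{max ‖Y‖ ‖Z‖} − 1)`; `trace_eq_of_det_exp_eq` — `det e^Y = det e^Z` with `card·(‖Y‖ + ‖Z‖) < 2π` ⇒ `tr Y = tr Z` (Liouville
   `Literature.Analysis.Matrix.det_exp_eq_exp_trace` + injectivity of `exp` on a strip); ★★ `norm_trace_exp_sub_trace_exp_le_of_det_eq`.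
 * §4 `abs_wt_sub_wt_le` · `abs_fineAction_sub_le` · `abs_levelAction_sub_le` — the VOLUME SUM: per-plaquette `card·τ`-closeness of traces ⇒ `|A^{(k)}(B) − A^{(k)}(B′)| ≤
   w^k·card(perWin)·τ` (the bookkeeping of part 34's letter `D`).
 * §3 THE REDUCTION FOR THE PIN (displayed inputs, no estimate asserted): ★★★ `norm_trace_cplaq_sub_le_of_det_eq_of_log_near` — for two coarse bond configurations `B, B′` (think: the
   (42)- and (0.4)-averages of the same small field) whose coarse plaquettes at a site are exponentials `P = e^Y`, `P′ = e^{Y′}` with (D) EQUAL DETERMINANTS and (S) `‖Y − Y′‖ ≤ β`,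
   `‖Y‖, ‖Y′‖ ≤ α`, `2·card·α < 2π`: `‖tr P − tr P′‖ ≤ card·β·(e^α − 1)`.  Summed over the `(N L^k)^4·6` coarse plaquettes of depth `k` with `α = O(εL^{−2k})`-type and `β = O(α²)`
   this is `O(ε³L^{−2k})·vol` — N16's rate `θ = L^{−2}` for part 34's letter `D` (bookkeeping of that sum is NOT done here); `…_conj` — the same with (S) up to a UNITARY
   CONJUGATION `‖Y′ − uYu⁻¹‖ ≤ β` (the actual geometry: in a local gauge the (0.4) plaquette is the `κ(y)`-conjugate of the (42) one up to second order; traces and determinants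
   do not see `κ`).
READING (honest; for the planners, D-0014).  The two displayed inputs of §3 for ((42), (0.4) of record): (D) = determinant transport through BOTH averages (dag-n16-w2 g7's announced
`…N16DetTransport` does it for (9)∕(42)∕(43); the (0.4)-of-record twin and the abelian exactness of parts 11∕13 complete it) — bookkeeping, M; (S) = second-order closeness of the
coarse plaquette LOGARITHMS (parts 22∕25∕26 give second-order closeness of the bond variables up to a local gauge; around a closed plaquette the gauge cancels; BCH bookkeeping —
`Literature.Analysis.Calculus.BCHProductLowOrder`) — M∕L.  Neither is proved here.

HONEST FRAMING.  [folklore] elementary Banach-algebra ∕ matrix analysis (series of the exponential, Liouville's formula from the tree, trace vs operator norm); 0 `def`, 0 `sorry`, no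
`instance`, no `notation`; NO statement about Bałaban's averages is proved here (§3's inputs are displayed); nothing of [Balaban1985Averaging] ∕ [Balaban1987RG1] asserted; K3⁸ stubs
`stub_rates13HV` ∕ `stub_expansion13HV` NOT touched; N16 ∕ NE3 NOT discharged; count-neutral (typed 28∕28 · discharged 5∕27 work-bound, A 5∕28 — unmoved).  One finite four-torus
programme at fixed `ε` — the Yang–Mills mass gap (Clay) is NOT proved by any of this; R4 closes the conditional finite-𝕋⁴ rung `BalabanLadder.UV` only; nothing continuum ∕ ℝ⁴ ∕ OS.
-/

set_option autoImplicit false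

open scoped BigOperators Matrix Matrix.Norms.L2Operator Nat
open NormedSpace

namespace Summit.QuantumFields.YangMills.BalabanUVNodes.N16TraceThirdOrderOfDetEq

noncomputable section

/-! ## §1 The exponential series with its first-order term removed — IN THE TREE: `Summit.QuantumFields.YangMills.Theorems.NewtonLiftFlat.norm_exp_sub_exp_sub_sub_le`
(`‖e^x − e^y − (x − y)‖ ≤ ‖x − y‖·(e^{max ‖x‖ ‖y‖} − 1)`, pub-ymgap's α-inputs lineage), imported and reused below. -/

/-! ## §2 Traces of exponentials with equal traces of the exponents -/

section Trace

variable {N : Type*} [Fintype N] [DecidableEq N]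

/-- An entry is bounded by the operator norm: `‖A_{ij}‖ ≤ ‖A‖` (`⟨e_i, Ae_j⟩`; the public statement of the Solovay–Kitaev file, re-derived to keep the import closure small). [folklore] -/
theorem norm_entry_le_norm (A : Matrix N N ℂ) (i j : N) : ‖A i j‖ ≤ ‖A‖ := by
  have h1 : ‖Matrix.toEuclideanCLM (n := N) (𝕜 := ℂ) A (PiLp.single 2 j (1 : ℂ) : EuclideanSpace ℂ N)‖ ≤ ‖A‖ := by
    refine (ContinuousLinearMap.le_opNorm _ _).trans ?_
    rw [PiLp.norm_single, norm_one, mul_one, Matrix.cstar_norm_def]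
  have h2 : ‖A i j‖ ≤ ‖Matrix.toEuclideanCLM (n := N) (𝕜 := ℂ) A (PiLp.single 2 j (1 : ℂ) : EuclideanSpace ℂ N)‖ := by
    have hval : (Matrix.toEuclideanCLM (n := N) (𝕜 := ℂ) A (PiLp.single 2 j (1 : ℂ) : EuclideanSpace ℂ N)) i = A i j := by
      simp [Matrix.mulVec, dotProduct]
    have h3 := PiLp.norm_apply_le (Matrix.toEuclideanCLM (n := N) (𝕜 := ℂ) A (PiLp.single 2 j (1 : ℂ) : EuclideanSpace ℂ N)) i
    rwa [hval] at h3
  exact h2.trans h1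

/-- `‖tr M‖ ≤ card·‖M‖` (operator norm). [folklore] -/
theorem norm_trace_le (M : Matrix N N ℂ) : ‖M.trace‖ ≤ Fintype.card N * ‖M‖ := by
  calc ‖M.trace‖ = ‖∑ i, M i i‖ := by simp [Matrix.trace]
    _ ≤ ∑ i, ‖M i i‖ := norm_sum_le _ _
    _ ≤ ∑ _i : N, ‖M‖ := Finset.sum_le_sum fun i _ => norm_entry_le_norm M i i
    _ = Fintype.card N * ‖M‖ := by simp

/-- **★★ TRACES OF EXPONENTIALS WITH EQUAL TRACES OF THE EXPONENTS**: `tr Y = tr Z` ⇒ `‖tr e^Y − tr e^Z‖ ≤ card·‖Y − Z‖·(e^{max ‖Y‖ ‖Z‖} − 1)` — the first-order term of the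
difference has trace zero, so the traces agree one order better than the exponentials do. [folklore] -/
theorem norm_trace_exp_sub_trace_exp_le_of_trace_eq [Nonempty N] (Y Z : Matrix N N ℂ) (htr : Y.trace = Z.trace) :
    ‖(exp Y).trace - (exp Z).trace‖ ≤ Fintype.card N * (‖Y - Z‖ * (Real.exp (max ‖Y‖ ‖Z‖) - 1)) := by
  have e : (exp Y).trace - (exp Z).trace = (exp Y - exp Z - (Y - Z)).trace := by
    rw [Matrix.trace_sub, Matrix.trace_sub, Matrix.trace_sub, htr, sub_self, sub_zero]
  rw [e]
  exact (norm_trace_le _).trans (mul_le_mul_of_nonneg_left (Summit.QuantumFields.YangMills.Theorems.NewtonLiftFlat.norm_exp_sub_exp_sub_sub_le Y Z) (by positivity))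

/-- `‖tr Y‖ ≤ card·‖Y‖`, so two small exponents whose exponentials have EQUAL DETERMINANTS have equal traces: `det e^Y = det e^Z`, `card·(‖Y‖ + ‖Z‖) < 2π` ⇒ `tr Y = tr Z`
(Liouville `det e^Y = e^{tr Y}`, `Literature.Analysis.Matrix.det_exp_eq_exp_trace`; `exp` is injective on a strip of height `< 2π`). [folklore] -/
theorem trace_eq_of_det_exp_eq (Y Z : Matrix N N ℂ) (hdet : (exp Y).det = (exp Z).det) (hsmall : Fintype.card N * (‖Y‖ + ‖Z‖) < 2 * Real.pi) :
    Y.trace = Z.trace := by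
  have h : Complex.exp Y.trace = Complex.exp Z.trace := by
    rw [Complex.exp_eq_exp_ℂ, ← Literature.Analysis.Matrix.det_exp_eq_exp_trace, ← Literature.Analysis.Matrix.det_exp_eq_exp_trace, hdet]
  obtain ⟨m, hm⟩ := Complex.exp_eq_exp_iff_exists_int.mp h
  have hbound : ‖Y.trace - Z.trace‖ < 2 * Real.pi := by
    refine (norm_sub_le _ _).trans_lt ?_
    have hY := norm_trace_le Y
    have hZ := norm_trace_le Z
    nlinarith
  rw [hm, add_sub_cancel_left] at hbound
  have hm0 : m = 0 := by
    by_contra hne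
    have h1 : (1 : ℝ) ≤ |(m : ℝ)| := by
      rw [← Int.cast_abs]; exact_mod_cast Int.one_le_abs hne
    have hnorm : ‖(m : ℂ) * (2 * Real.pi * Complex.I)‖ = |(m : ℝ)| * (2 * Real.pi) := by
      rw [norm_mul, Complex.norm_intCast, norm_mul, Complex.norm_I, mul_one, Complex.norm_mul, Complex.norm_real, Complex.norm_ofNat,
        Real.norm_eq_abs, abs_of_pos Real.pi_pos]
    rw [hnorm] at hbound
    nlinarith [Real.pi_pos]
  rw [hm, hm0]
  simp

/-- **★★ EQUAL DETERMINANTS + CLOSE SMALL LOGARITHMS ⇒ TRACES AGREE ONE ORDER BETTER**: `det e^Y = det e^Z`, `card·(‖Y‖ + ‖Z‖) < 2π` ⇒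
`‖tr e^Y − tr e^Z‖ ≤ card·‖Y − Z‖·(e^{max ‖Y‖ ‖Z‖} − 1)`. [folklore] -/
theorem norm_trace_exp_sub_trace_exp_le_of_det_eq [Nonempty N] (Y Z : Matrix N N ℂ) (hdet : (exp Y).det = (exp Z).det)
    (hsmall : Fintype.card N * (‖Y‖ + ‖Z‖) < 2 * Real.pi) :
    ‖(exp Y).trace - (exp Z).trace‖ ≤ Fintype.card N * (‖Y - Z‖ * (Real.exp (max ‖Y‖ ‖Z‖) - 1)) :=
  norm_trace_exp_sub_trace_exp_le_of_trace_eq Y Z (trace_eq_of_det_exp_eq Y Z hdet hsmall)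

end Trace

/-! ## §3 The reduction for the pin: coarse plaquettes of two averages with equal determinants and second-order close logarithms -/

section Reduction

open Literature.MathematicalPhysics.QuantumFieldTheory.Balaban1983to89
open B7Prop1Explicit B7Prop2Explicit

variable {d : ℕ} {N : Type*} [Fintype N] [DecidableEq N] [Nonempty N]

/-- **★★★ THE REDUCTION** (inputs displayed; think `B = bavg L U`, `B′ =` the (0.4)-average of the same small field read on the fold).  If at the coarse plaquette `(z, μ, ν)` the two
plaquette variables are exponentials `cplaq L B z μ ν = e^{Y}`, `cplaq L B′ z μ ν = e^{Y′}` of small exponents (`‖Y‖, ‖Y′‖ ≤ α`, `2·card·α < 2π`) with (D) EQUAL DETERMINANTS and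
(S) `‖Y − Y′‖ ≤ β`, then the plaquette TRACES agree to `card·β·(e^α − 1)` — third order when `α = O(a)`, `β = O(a²)`; ZERO in the abelian case (`β = 0`).  The per-plaquette input of part
34's one-step ACTION discrepancy `D`. [folklore] -/
theorem norm_trace_cplaq_sub_le_of_det_eq_of_log_near (L : ℕ) (B B' : Site d → Fin d → (Matrix N N ℂ)ˣ) (z : Site d) (μ ν : Fin d) {Y Y' : Matrix N N ℂ} {α β : ℝ}
    (hY : ((cplaq L B z μ ν : (Matrix N N ℂ)ˣ) : Matrix N N ℂ) = exp Y) (hY' : ((cplaq L B' z μ ν : (Matrix N N ℂ)ˣ) : Matrix N N ℂ) = exp Y')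
    (hYα : ‖Y‖ ≤ α) (hY'α : ‖Y'‖ ≤ α) (hα : 2 * Fintype.card N * α < 2 * Real.pi)
    (hdet : ((cplaq L B z μ ν : (Matrix N N ℂ)ˣ) : Matrix N N ℂ).det = ((cplaq L B' z μ ν : (Matrix N N ℂ)ˣ) : Matrix N N ℂ).det)
    (hβ : ‖Y - Y'‖ ≤ β) :
    ‖((cplaq L B z μ ν : (Matrix N N ℂ)ˣ) : Matrix N N ℂ).trace - ((cplaq L B' z μ ν : (Matrix N N ℂ)ˣ) : Matrix N N ℂ).trace‖
      ≤ Fintype.card N * (β * (Real.exp α - 1)) := by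
  rw [hY, hY']
  rw [hY, hY'] at hdet
  have hsmall : Fintype.card N * (‖Y‖ + ‖Y'‖) < 2 * Real.pi := by
    have hc : (0 : ℝ) ≤ Fintype.card N := by positivity
    nlinarith
  refine (norm_trace_exp_sub_trace_exp_le_of_det_eq Y Y' hdet hsmall).trans ?_
  refine mul_le_mul_of_nonneg_left ?_ (by positivity)
  have hexp : Real.exp (max ‖Y‖ ‖Y'‖) - 1 ≤ Real.exp α - 1 := by
    have := Real.exp_le_exp.mpr (max_le hYα hY'α); linarith
  have hexp0 : 0 ≤ Real.exp (max ‖Y‖ ‖Y'‖) - 1 := by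
    have : (1 : ℝ) ≤ Real.exp (max ‖Y‖ ‖Y'‖) := Real.one_le_exp ((norm_nonneg Y).trans (le_max_left _ _)); linarith
  exact mul_le_mul hβ hexp hexp0 ((norm_nonneg _).trans hβ)

/-- **THE SAME UP TO A UNITARY CONJUGATION** (the geometry of the pin: in a LOCAL gauge on the plaquette the (0.4) bond variables are the `κ`-gauge transform of the (42) ones up to
second order — parts 22∕25∕26 — so the coarse plaquettes satisfy `P′ ≈ κ(y)Pκ(y)⁻¹`, and traces ∕ determinants do not see `κ`): `P = e^Y`, `P′ = e^{Y′}`, `u` unitary, (D) `det P = det P′`,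
(S) `‖Y′ − uYu⁻¹‖ ≤ β`, `‖Y‖, ‖Y′‖ ≤ α`, `2·card·α < 2π` ⇒ `‖tr P − tr P′‖ ≤ card·β·(e^α − 1)`. [folklore] -/
theorem norm_trace_cplaq_sub_le_of_det_eq_of_log_near_conj (L : ℕ) (B B' : Site d → Fin d → (Matrix N N ℂ)ˣ) (z : Site d) (μ ν : Fin d) {Y Y' : Matrix N N ℂ} {α β : ℝ}
    (u : (Matrix N N ℂ)ˣ) (hu : u ∈ unitaryUnits (Matrix N N ℂ))
    (hY : ((cplaq L B z μ ν : (Matrix N N ℂ)ˣ) : Matrix N N ℂ) = exp Y) (hY' : ((cplaq L B' z μ ν : (Matrix N N ℂ)ˣ) : Matrix N N ℂ) = exp Y')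
    (hYα : ‖Y‖ ≤ α) (hY'α : ‖Y'‖ ≤ α) (hα : 2 * Fintype.card N * α < 2 * Real.pi)
    (hdet : ((cplaq L B z μ ν : (Matrix N N ℂ)ˣ) : Matrix N N ℂ).det = ((cplaq L B' z μ ν : (Matrix N N ℂ)ˣ) : Matrix N N ℂ).det)
    (hβ : ‖Y' - (u : Matrix N N ℂ) * Y * ((u⁻¹ : (Matrix N N ℂ)ˣ) : Matrix N N ℂ)‖ ≤ β) :
    ‖((cplaq L B z μ ν : (Matrix N N ℂ)ˣ) : Matrix N N ℂ).trace - ((cplaq L B' z μ ν : (Matrix N N ℂ)ˣ) : Matrix N N ℂ).trace‖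
      ≤ Fintype.card N * (β * (Real.exp α - 1)) := by
  -- replace `P = e^Y` by its conjugate `u P u⁻¹ = e^{uYu⁻¹}`: same trace, same determinant, same norm of the exponent
  letI : NormedAlgebra ℚ (Matrix N N ℂ) := NormedAlgebra.restrictScalars ℚ ℂ (Matrix N N ℂ)
  set Yu : Matrix N N ℂ := (u : Matrix N N ℂ) * Y * ((u⁻¹ : (Matrix N N ℂ)ˣ) : Matrix N N ℂ) with hYu
  have hexpu : exp Yu = (u : Matrix N N ℂ) * exp Y * ((u⁻¹ : (Matrix N N ℂ)ˣ) : Matrix N N ℂ) := exp_units_conj u Y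
  have htr : (exp Yu).trace = (exp Y).trace := by
    rw [hexpu, Matrix.trace_mul_cycle, Units.inv_mul, one_mul]
  have hdetu : (exp Yu).det = (exp Y).det := by
    rw [hexpu, Matrix.det_mul, Matrix.det_mul, mul_comm ((u : Matrix N N ℂ).det * (exp Y).det), ← mul_assoc, ← Matrix.det_mul,
      Units.inv_mul, Matrix.det_one, one_mul]
  have hnormu : ‖Yu‖ = ‖Y‖ := by
    rw [hYu, CStarRing.norm_mul_mem_unitary _ (mem_unitaryUnits.mp ((unitaryUnits _).inv_mem hu)), CStarRing.norm_mem_unitary_mul _ (mem_unitaryUnits.mp hu)]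
  rw [hY, hY']
  rw [hY, hY'] at hdet
  rw [← htr]
  have hsmall : Fintype.card N * (‖Yu‖ + ‖Y'‖) < 2 * Real.pi := by
    rw [hnormu]; have hc : (0 : ℝ) ≤ Fintype.card N := by positivity
    nlinarith
  have hdet' : (exp Yu).det = (exp Y').det := by rw [hdetu, hdet]
  refine (norm_trace_exp_sub_trace_exp_le_of_det_eq Yu Y' hdet' hsmall).trans ?_
  refine mul_le_mul_of_nonneg_left ?_ (by positivity)
  have hexp : Real.exp (max ‖Yu‖ ‖Y'‖) - 1 ≤ Real.exp α - 1 := by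
    rw [hnormu]; have := Real.exp_le_exp.mpr (max_le hYα hY'α); linarith
  have hexp0 : 0 ≤ Real.exp (max ‖Yu‖ ‖Y'‖) - 1 := by
    have : (1 : ℝ) ≤ Real.exp (max ‖Yu‖ ‖Y'‖) := Real.one_le_exp ((norm_nonneg Yu).trans (le_max_left _ _)); linarith
  have hβ' : ‖Yu - Y'‖ ≤ β := by rw [norm_sub_rev]; exact hβ
  exact mul_le_mul hβ' hexp hexp0 ((norm_nonneg _).trans hβ')

end Reduction

/-! ## §4 The volume sum: per-plaquette trace closeness ⇒ closeness of the level actions (the bookkeeping of part 34's letter `D`) -/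

section Volume

open Literature.MathematicalPhysics.QuantumFieldTheory.Balaban1983to89
open B7Prop1Explicit UnitaryModel
open T4AveragingDeficitWall hiding Site Plane Bond
open T4AveragingDeficitWall (Plaq)
open Summit.QuantumFields.BalabanUV.T4Continuum MinimalActionLevels

variable {d : ℕ} {N : Type*} [Fintype N] [DecidableEq N] [Nonempty N]

/-- Plaquette traces `card·τ`-close ⇒ Wilson weights `τ`-close (`wt W = 1 − Re tr W ∕ card`). [folklore] -/
theorem abs_wt_sub_wt_le {P P' : (Matrix N N ℂ)ˣ} {τ : ℝ} (h : ‖(P : Matrix N N ℂ).trace - (P' : Matrix N N ℂ).trace‖ ≤ Fintype.card N * τ) :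
    |wt P - wt P'| ≤ τ := by
  have hc : (0 : ℝ) < Fintype.card N := by exact_mod_cast Fintype.card_pos
  have e : wt P - wt P' = -(((P : Matrix N N ℂ).trace - (P' : Matrix N N ℂ).trace).re / Fintype.card N) := by
    simp only [wt, nReTr, Complex.sub_re]; ring
  rw [e, abs_neg, abs_div, abs_of_pos hc, div_le_iff₀ hc]
  calc |((P : Matrix N N ℂ).trace - (P' : Matrix N N ℂ).trace).re| ≤ ‖(P : Matrix N N ℂ).trace - (P' : Matrix N N ℂ).trace‖ := Complex.abs_re_le_norm _
    _ ≤ Fintype.card N * τ := h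
    _ = τ * Fintype.card N := mul_comm _ _

/-- **THE VOLUME SUM**: if at every plaquette of a window the fine plaquette traces of two configurations are `card·τ`-close, their fine Wilson actions on the window are `card(W)·τ`-close. [folklore] -/
theorem abs_fineAction_sub_le {B B' : Site d → Fin d → (Matrix N N ℂ)ˣ} (W : Finset (Plaq d)) {τ : ℝ}
    (h : ∀ p ∈ W, ‖((fhol B p : (Matrix N N ℂ)ˣ) : Matrix N N ℂ).trace - ((fhol B' p : (Matrix N N ℂ)ˣ) : Matrix N N ℂ).trace‖ ≤ Fintype.card N * τ) :
    |fineAction B W - fineAction B' W| ≤ W.card * τ := by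
  unfold fineAction
  rw [← Finset.sum_sub_distrib]
  refine (Finset.abs_sum_le_sum_abs _ _).trans ?_
  calc ∑ p ∈ W, |wt (fhol B p) - wt (fhol B' p)| ≤ ∑ _p ∈ W, τ := Finset.sum_le_sum fun p hp => abs_wt_sub_wt_le (h p hp)
    _ = W.card * τ := by rw [Finset.sum_const, nsmul_eq_mul]

/-- **… AND OF THE LEVEL ACTIONS**: `|A^{(k)}(B) − A^{(k)}(B′)| ≤ w^k · card(perWin(N·L^k)) · τ` — for `d = 4` (`w = 1`) and `τ = O(ε³L^{−6k})` per plaquette (part 35 §3 at the depth-`k`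
radius) this is `O(ε³)·(NL^k)^4·6·L^{−6k} = O(ε³ L^{−2k})·N^4`: N16's rate for part 34's letter `D`. [folklore] -/
theorem abs_levelAction_sub_le (L M k : ℕ) (hL : 1 ≤ L) {B B' : Site d → Fin d → (Matrix N N ℂ)ˣ} {τ : ℝ}
    (h : ∀ p ∈ perWin d (M * L ^ k), ‖((fhol B p : (Matrix N N ℂ)ˣ) : Matrix N N ℂ).trace - ((fhol B' p : (Matrix N N ℂ)ˣ) : Matrix N N ℂ).trace‖ ≤ Fintype.card N * τ) :
    |levelAction d L M k B - levelAction d L M k B'| ≤ ((stepWt d L)⁻¹) ^ k * ((perWin d (M * L ^ k)).card * τ) := by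
  have hc : 0 ≤ ((stepWt d L)⁻¹) ^ k := pow_nonneg (inv_nonneg.mpr (stepWt_pos (d := d) L hL).le) _
  unfold levelAction
  rw [← mul_sub, abs_mul, abs_of_nonneg hc]
  exact mul_le_mul_of_nonneg_left (abs_fineAction_sub_le _ h) hc

end Volume

end

end Summit.QuantumFields.YangMills.BalabanUVNodes.N16TraceThirdOrderOfDetEq
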